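import Mathlib
import HarnessLib
import HarnessLib.Audit
import Summits.KontsevichZagierPeriods.Statement
import Literature.NumberTheory.Transcendental.KZCalculusProofs
import Literature.NumberTheory.Transcendental.KZProduct
import HarnessLib.Audit.Status.Attr

/-!
Route: Neg

DORMANT since 2026-08-23T19:01:03Z (reconciler: no traction for 6.2 d (last activity item-evidence-added at 2026-08-17T14:22:03Z); parked, not closed — `ledger route dormant route-KontsevichZagierPeriods-Neg --off` to reactivate) — unstaffed, not closed; items shared with open routes are served there. `ledger route dormant <id> --off` reactivates.

# Route Neg — KontsevichZagierPeriods: the literal rules calculus has surplus strength (refutation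
route; survey 2026-08-13, repaired 2026-08-15, crux-only deciding theorem 2026-08-16)

## Thesis X
Words: the H21-LITERAL statement is false: there are two integral representations of KZ's rational
shape with the same
value that are not connected by finitely many instances of the four fixed moves (additivity in the
domain and in the
integrand, ℚ-semialgebraic change of variables, Newton–Leibniz along the last coordinate with a
ℚ-semialgebraic primitive
continuous on the closed fibres), even if the period conjecture in its motivic (Nori / formal period
algebra) form is true.
Lean: `¬ KontsevichZagierPeriods`
Deciding theorem (CRUX-ONLY since route-repair gen 3, 2026-08-16): `closes : CancellationGap → ¬
KontsevichZagierPeriods`,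
PROVED in the route file over proved cone material only — Fubini for the hand-written product
representations
(KZ.IntegralRep.setIntegral_prodFun, KZProduct.lean), soundness of the moves
(KZ.Equivalent.value_eq_holds), cancellation
of the non-zero REAL number ∫s (mul_right_cancel₀), passage to move-equivalent RATIONAL
representations
(KZ.exists_isRational_equivalent_holds), the summit, Equivalent.trans/symm. The route has two
ALTERNATIVE witnesses, each
of which alone refutes the summit, so exactly one of them can head `closes` at a time: crux #3
CancellationGap (r×s ~ r'×s by
the moves with ∫s ≠ 0 but r ≁ r': the calculus cannot cancel a non-zero period) heads it now because
its derivation needs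
no unproved lemma; crux #2 NegTriplicationNotAccessible (0311, rank 2, the most informative bet: the
Gauss-triplication pair
is not KZ-equivalent) refutes the summit together with the Gauss value identity TriplicationValueEq
(1030, a theorem of
1812, support, provable now) — that spine is recorded as the Assembly item
`(NegTriplicationNotAccessible ∨ CancellationGap) → TriplicationValueEq → ¬ KontsevichZagierPeriods`
(provable now: branch 1
is the rev-2 deciding theorem kept verbatim in the planner's notes, branch 2 is `closes`) and
re-heads `closes` as
`closes (h : NegTriplicationNotAccessible)`, with 1030 invoked as a landed lemma, as soon as 1030 is
proved in Theorems/.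

Rationale: WHY THIS LINE. Statement.lean fixes ONE reading of KZ's rule 3) and of "pass from one formula to
another" (ℤ-span of move instances; absolutely convergent ℚ-semialgebraic intermediates;
ℚ-semialgebraic primitives, fibrewise continuous on the closed band — no C¹-on-a-neighbourhood
demand, corrected here after the 2026-08-14 retriage note) and disclaims equivalence with the
cohomological/Nori form [KontsevichZagier2001 §1.2; HuberMullerStachPeriods2017 Ch. 13, whose Rem.
13.1.8 records the experts' doubt that a rules presentation gives all relations]. Neg bets that this
literal calculus is strictly weaker than "all motivic relations" and names where: (b) Γ-DETOURS —
beta-product identities forced by Gauss multiplication are proved in print only through Γ (an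
exponential period) or through Hodge classes on Fermat varieties [Deligne1982HodgeCycles I Thm 7.15,
Rem. 7.16; Shioda1979; Aoki1987; Das2000]; (a) REGULARISATION — motivic derivations of MZV relations
pass through regularised divergent integrals while every H21 intermediate must converge absolutely;
(c) PRIMITIVES — a variable is never integrated out against log/arctan; (d) CANCELLATION (added
2026-08-15) — identities classically proved by multiplying both sides by a period (π, or the
identity's own other side, i.e. squaring) and dividing back: FormalRep/relations is a commutative
ring with the proved ideal property (KZProduct, KZProductIdeal) but nothing short of the summit
makes it a domain, i.e. lets one cancel a non-zero period. Imported areas: CM/Hodge theory of Fermat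
varieties (to choose test identities whose only known proofs leave the calculus), the ring structure
of the move group (cancellation), proof theory of the calculus (obstruction shape 0313: any
refutation of #2 is an additive invariant killing the four move sets); certified numerics only to
check values.
RANKED CRUXES. #2 NegTriplicationNotAccessible (0311) — the Gauss-triplication pair (the product of
beta integrands x^{-8/9}(1-x)^{-5/9}·y^{-4/9}(1-y)^{-2/9} on (0,1)², value B(1/9,4/9)B(5/9,7/9),
against the constant 3^{7/6}/2 on the disc of radius 2; both 22.63712829483…) is NOT KZ-equivalent
(why it might fail: the identity is a Lefschetz-(1,1) divisor relation on the degree-9 Fermat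
surface and routes FermatIsogeny / TerasomaCovering / MultivaluedCoV are compiling exactly that
correspondence into moves; sources Deligne1982HodgeCycles, KoblitzRohrlich1978, Shioda1979,
Aoki1987). The most informative item of the tree either way; kill switch of three positive routes;
it refutes the summit together with the theorem-grade support TriplicationValueEq (Assembly, branch
1). #3 CancellationGap (2026-08-15; heads the crux-only deciding theorem `closes` since 2026-08-16)
— ∃ r r' s with s.value ≠ 0 such that r×s and r'×s (products written out by hand) are
move-equivalent but r, r' are not: the calculus proves the identity after multiplying both sides by
the same non-zero period ∫s but cannot cancel it (why it might fail: cancellation may simply hold —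
for s = [0,1] it is one Newton–Leibniz move, the motivic shadow "effective → localised formal
periods is injective" is expected though open, HuberWustholz2022 App. A.4, AyoubRelKZRevisited Rem.
1.3 — and no instance is in hand; sources KontsevichZagier2001 §4.1, HuberWustholz2022, Ayoub2014,
Das2000). It is the weakest common form of two named bets: π-cancellation failure (item 0542
AyoubNotPiCancellation of route AyoubSpecialisation implies it, by commutativity modulo relations,
proved in KZProductIdeal) and the SQUARE-ROOT GAP (s = r ⊔ r', a disjoint translated union, for a
Das-type Koblitz–Ogus Γ-monomial identity whose square is a distribution relation but whose sign is
a quadratic "double covering" datum, Das2000, Deligne1982HodgeCycles n. 22). Strictly stronger than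
¬summit (the summit embeds FormalRep/relations into ℝ), strictly weaker than 0542; NOT killed by the
provable torsion-freeness of FormalRep/relations (c ≡ (n•c)·[0,1/n]) because s is not a unit.
KILL CRITERIA. A proof of general cancellation (r×s ~ r'×s ∧ s.value ≠ 0 ⇒ r ~ r') from the four
moves refutes #3, the crux heading `closes`: repair within the grace window by re-heading `closes`
with #2 (`closes (h : NegTriplicationNotAccessible)`, TriplicationValueEq 1030 landed in Theorems/
or proved inline), else the route closes `refuted:CancellationGap`. A proof of
TriplicationAccessible (0312; FermatIsogeny's IsogenyLinearNinth + DirichletNinth + ReflectionNinth,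
or TerasomaCovering's 3-chain) refutes #2: pressure point (b) dies at its first instance and the
route narrows to #3 (instantiate #3 with a named Das-type pair; the Assembly item is restated
without branch 1). Both refuted ⇒ close exhausted. A proof of NoriTransfer's transfer cruxes (rules
relations = Nori relations) makes ¬summit ⟺ ¬(formal period conjecture): close as superseded — Neg
explicitly does not bet against the period conjecture.
NOT DECOMPOSED YET. Which invariant separates the #2 pair (candidates: definability / o-minimal
complexity of the (domain, integrand) data, absolute-convergence-sensitive gradings; Hodge or
motivic data cannot work since the identity is motivic). Which explicit Das-type monomial
instantiates #3 (Das2000 is not held, acq-01271; first grounder task: extract the smallest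
Koblitz–Ogus monomial not generated by the standard relations, check numerically that its square is,
and file the pair as a support instance of #3). TriplicationValueEq (1030) is deliberately NOT
inlined into `closes` (Gauss multiplication at 1/9 + two real beta integrals + Tonelli: a prover's
item; the refuter briefing GaussPair.lean attached to 1030 reduces it to gaussRep.value =
discRep.value) — landing it is what lets #2 head the deciding theorem. The decidability angle
(summit ⇒ equality of periods is Σ⁰₁ relative to the side-condition oracle; Yoshinaga2008) is
recorded only. No glued split before #2 or #3 moves.
CHEAPEST FALSIFIER. For #2: FermatIsogeny's supports DirichletNinth (a 5-move paper chain) and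
ReflectionNinth reduce 0312 to ONE ℚ̄-linear relation between two 1-dimensional beta representations
(IsogenyLinearNinth, the Koblitz–Rohrlich isogeny L_{1,1,7} ~ L_{3,1,5} of J(F₉)); if a grounder
certifies that divisor and its action compiles into moves, #2 is dead — check that first. For #3:
settle cancellation by [π] in the 1-dimensional sector (PiCancellation, item 0540): a proof there
removes the only instance in hand.
SUPPORT. TriplicationAccessible (0312; kill switch, shared with FermatIsogeny / TerasomaCovering /
MultivaluedCoV); NegObstructionShape (0313; provable now by AddSubgroup.closure_le — the template
any refutation of #2 must fit); TriplicationValueEq (1030; a theorem, Gauss 1812: Tonelli + Mathlib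
betaIntegral + GaussMultiplicationFormula_holds; the lemma that re-heads `closes` with #2 once
landed). Assembly (11008) = (NegTriplicationNotAccessible ∨ CancellationGap) → TriplicationValueEq →
¬KontsevichZagierPeriods: both spines in one item, provable now (branch 1 = the rev-2 deciding
theorem over KZ.exists_isRational_equivalent_holds + KZ.Equivalent.value_eq_holds; branch 2 =
`closes`; planner SketchGlue.lean rc 0). Dropped: TriplicationPairRefutes 1033 (2026-08-15, its
statement was the rev-2 deciding theorem), ExistsIsRationalEquivalentHolds 0314 (2026-08-15,
discharged in Literature as KZ.exists_isRational_equivalent_holds), CancellationGapRefutes 11012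
(2026-08-16: its statement IS the crux-only deciding theorem `closes`, now proved in the route file
— same rule as 1033).
SOURCES. KontsevichZagier2001; HuberMullerStachPeriods2017; HuberWustholz2022; Ayoub2014; Ayoub2015;
AyoubRelKZRevisited; Deligne1982HodgeCycles; KoblitzRohrlich1978; Shioda1979; Aoki1987; Das2000;
CressonViusos2022; Waldschmidt2006; Yoshinaga2008.

Novelty: NOVELTY (search-before-claim, 2026-08-14: lit search --hybrid and lit vsearch over the held store;
lit frontier KontsevichZagierPeriods --since 2020; lit bridges --cross any; lit galaxy search --star
pdf "counterexample to the Kontsevich-Zagier" and "Kontsevich-Zagier conjecture is false" (0 hits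
each); crossref; remote OpenAlex, S2, arXiv were rate-limited).
Nearest prior art found:
(1) HuberMullerStachPeriods2017 Rem. 13.1.8 (= 2015 draft Rem. 12.1.7, read in
paper:galaxy-pdf-1872635349266679900 p. 32): "it is not clear to us if [Kontsevich's symbols with
the Stokes relation] also give all relations" of the formal period algebra: the experts' recorded
doubt that a rules presentation with top-degree forms captures every motivic relation. No candidate
missing relation is proposed there.
(2) Ayoub2015 Rem. 1.2 (quoted in the barrier file of
Literature.Barriers.KontsevichZagierPeriods.noSemialgebraicPrimitive_inv_sub_two ): the compact form
of Conjecture 1 "a peu de chance d'être vraie si l'on fixe le nombre de variables à l'avance". A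
doubt about a RESTRICTED form only; the H21 calculus does not fix the number of variables
(Literature.NumberTheory.Transcendental.KZ.Equivalent compares representations of all dimensions),
so it does not transfer as is.
(3) CressonViusos2022 (arXiv:1912.01751) §3.2 with Viusos2020 (arXiv:1509.01097): reformulation of
Conjecture 1 through volumes of compact semialgebraic sets and the PL-GKZ conjecture, and the only
printed counterexample-hunting s  [refs: 10.1090/s0002-9947-00-02417-x, 1912.01751, 1509.01097, paper:galaxy-pdf-1872635349266679900, doi:10.1090/s0002-9947-00-02417-x, paper:galaxy-pdf-8405055998839152860, HuberMullerStachPeriods2017, Ayoub2015, CressonViusos2022, Viusos2020, KontsevichZagier2001, Shioda1979, Aoki1987, Das2000, HuberWustholz2022]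

Barriers (technique_class: counterexample, additive-invariant, kz-rules-incompleteness): BARRIERS (catalogue Literature/Barriers/KontsevichZagierPeriods: 4 files, 6 tagged declarations;
technique_class of this route: counterexample, additive-invariant, kz-rules-incompleteness).
- Literature.Barriers.KontsevichZagierPeriods.noSemialgebraicPrimitive_inv_sub_two
[primitive-elimination, fixed-number-of-variables]: blocks a PROOF strategy for the summit
(integrate out one variable with an admissible primitive). For Neg it is a resource rather than an
obstacle (it is pressure point (c) made precise and proved), but its printed scope caveat cuts
against Neg too: "an example defeating one proof strategy, not a no-go" (the identity ∫₀¹dt/(2−t) =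
∫₁²dt/t is a single change of variables). Neg must show that NO finite chain of moves exists, which
needs a global invariant (item 0313), not the failure of the obvious chain. Not evaded; this is
exactly the gap between pressure point (c) and a refutation.
- Literature.Barriers.KontsevichZagierPeriods.kzConjecture_implies_oddZetaAlgIndep ,
Literature.Barriers.KontsevichZagierPeriods.kzConjecture_implies_twoPiI_log_algIndep ,
Literature.Barriers.KontsevichZagierPeriods.kzConjecture_implies_ellipticPeriods_algIndep
[strength-barrier, all-techniques]: they block POSITIVE routes (any proof of the summit proves
Grothendieck-period-conjecture consequences out of reach of transcendence theory). They do not block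
a refutation; on the contrary they record that the literal rules form sits at or above the formal
period conjecture and GPC (Hu

History (route lifecycle, newest last):
- 2026-08-15T16:37:17Z · rev 2: restated Assembly (stmt-KontsevichZagierPeriods-0310) — route-repair (rbadge g2): glue PROVED — closes : NegTriplicationNotAccessible → TriplicationValueEq → ¬KontsevichZagierPeriods (KZ.exists_isRational_equivalent_ (planner-rbadge-KontsevichZagierPeriods-Neg-f4e4ec05-g2-0)
- 2026-08-15T16:37:17Z · rev 2: dropped TriplicationPairRefutes, ExistsIsRationalEquivalentHolds — route-repair (rbadge g2): glue PROVED — closes : NegTriplicationNotAccessible → TriplicationValueEq → ¬KontsevichZagierPeriods (KZ.exists_isRational_equivalent_ (planner-rbadge-KontsevichZagierPeriods-Neg-f4e4ec05-g2-0)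
- 2026-08-16T06:17:01Z · rev 7: dropped CancellationGapRefutes — route-repair gen 3 (rbadge), step 2/3 — CRUX-ONLY DECIDING THEOREM (gate stamp glue.non-crux-hypothesis on TriplicationValueEq + route.crux-floor): closes := (h (planner-rbadge-KontsevichZagierPeriods-Neg-f4e4ec05-g3-0)
- 2026-08-23T19:01:03Z · DORMANT — reconciler: no traction for 6.2 d (last activity item-evidence-added at 2026-08-17T14:22:03Z); parked, not closed — `ledger route dormant route-KontsevichZagier (operator:999:584144)

sub-problem: KontsevichZagierPeriods · status: dormant · opened planner-KontsevichZagierPeriods-Survey-0 2026-08-13T06:10:22Z · rev 7 · ledger route-KontsevichZagierPeriods-Neg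
GENERATED by the gate from the ledger (D-0016/17). Provers cite these decls: `theorem foo : Summit.KontsevichZagierPeriods.KontsevichZagierPeriods.Theses.Neg.<Decl> := …` in Summits/KontsevichZagierPeriods/KontsevichZagierPeriods/Theorems/<Name>.lean.
-/

namespace Summit.KontsevichZagierPeriods.KontsevichZagierPeriods.Theses.Neg

open scoped BigOperators Topology Manifold Classical MeasureTheory ProbabilityTheory Matrix InnerProductSpace ComplexConjugate ContinuousMap
open Filter Set Function TopologicalSpace MeasureTheory

attribute [summit_statement] _root_.KontsevichZagierPeriods

open Literature Periods

/-- item stmt-KontsevichZagierPeriods-0309 · target · rank 0 · open · by planner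
why it might fail: Conjecture 1 may simply hold: its formal version <=> GPC for all Nori motives (HMS17 Prop 13.2.6), a theorem for Q̄-linear relations of 1-periods (HW22 Thm 13.3) and in Ayoub's relative setting (Ayoub2015 Thm 1.8); no additive invariant of FormalRep separating two equal-valued reps is known.
sources: HuberMullerStachPeriods2017, Prop. 13.2.6 and Rem. 13.1.8 (2015 draft Rem. 12.1.7, read: paper:galaxy-pdf-1872635349266679900 p. 32), HuberWustholz2022, Thm 13.3 (Prologue pp. 10-11 read), Ayoub2015, Thm 1.8 and Rem. 1.2, CressonViusos2022 = arXiv:1912.01751, Thm 4.1 and Prop. 3.2, Literature.NumberTheory.Transcendental.KZ.relations_le_ker_eval_holds + Literature.NumberTheory.Transcendental.KZ.exists_isRational_equivalent_holds (both Assembly hypotheses are now theorems), Literature.NumberTheory.Transcendental.KZ.newtonLeibnizRel (design note: no C¹-up-to-boundary demand; primitive semialgebraic on the band only)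
Negative side of the problem statement, staffed as its own item. Bet: the specific finite calculus
fixed in KZCalculus.lean (absolutely convergent semialgebraic intermediates; Newton–Leibniz with
ℚ-semialgebraic C¹ primitives) misses some true identity between rational integral representations —
pressure points: regularisation (MZV double shuffle), Γ-function detours (Gauss multiplication beta
identities), transcendental primitives. [elaborates: yes: _survey/SketchA.lean; sources:
KontsevichZagier2001, HuberMullerStach2017, Waldschmidt2006] -/
@[route_item "route-KontsevichZagierPeriods-Neg"]
def NegThesis : Prop :=
  ¬ KontsevichZagierPeriods

/-- item stmt-KontsevichZagierPeriods-0311 · crux · rank 2 · open · by planner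
why it might fail: May be KZ-equivalent: identity is Deligne's Γ̃(a)∈Q̄, a=(1,4,7,6), on the degree-9 Fermat surface; its Hodge class is a divisor class (Lefschetz (1,1); cycles Shioda1979, Aoki1987), i.e. a correspondence = piecewise-algebraic change of variables; refuting needs an invariant finer than Hodge
sources: Deligne1982HodgeCycles, I Lemma 7.12, Thm 7.15, Rem 7.16(a) (LNM 900 pp 72-75 read): a=(1,4,7,6), d=9, n=2 has <ua>=2 for all units u, so 7.15 applies; Γ̃(a)=(2πi)^-2·Γ(1/9)Γ(4/9)Γ(7/9)Γ(6/9)=-3^(-1/3) (checked) <=> B(1/9,4/9)B(5/9,7/9)=2·3^(7/6)π modulo the reflection value B(1/3,2/3)=2π/√3, Shioda1979 = doi:10.1007/bf01428804 (Hodge classes on Fermat varieties; (1,4,7,6) is not of line type (a,-a,b,-b)), Aoki1987 = doi:10.2969/jmsj/03930385 (explicit non-standard cycles, 3 | degree), KontsevichZagier2001, §1.2 Conjecture 1 and rule 3), sibling items: Neg.TriplicationAccessible (0312, its negation); ExpConservative.ExpTriplicationAccessibleV3 (0544, same pair in KZexp), Waldschmidt2006 (Rohrlich–Lang: Γ-relations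 from translation/reflection/multiplication only)
r: 2-dim rep on (0,1)² with integrand x^{−8/9}(1−x)^{−5/9}·y^{−4/9}(1−y)^{−2/9} (value
B(1/9,4/9)·B(5/9,7/9)); r': constant 3^{7/6}/2 on the open disc of radius 2 (value 2π·3^{7/6});
equality of values = Gauss multiplication Γ(1/9)Γ(4/9)Γ(7/9) = 2π·3^{1/6}Γ(1/3) and Γ(4/3) =
Γ(1/3)/3 (numerically 22.63712829483…, both sides). Refuting the ∀ requires an additive invariant of
FormalRep vanishing on the four move sets (shape: crux #4) but not on [r]−[r']. Motivic background:
the identity corresponds to a Hodge class on a product of Fermat curves of degree 9 that is absolute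
Hodge (Deligne1982HodgeCycles §7) — an invariant must therefore see something finer than
Hodge/motivic data, e.g. absolute integrability of all intermediate reps or ℚ-semialgebraicity of
primitives. Settling this item either way is the most informative event for the whole tree.
[elaborates: yes: _survey/SketchB.lean; sources: Deligne1982HodgeCycles, Waldschmidt2006,
KontsevichZagier2001] -/
@[route_item "route-KontsevichZagierPeriods-Neg"]
def NegTriplicationNotAccessible : Prop :=
  ¬ (∀ (r r' : Literature.NumberTheory.Transcendental.KZ.IntegralRep 2), r.domain = {x | ∀ i, x i ∈ Set.Ioo (0:ℝ) 1} → Set.EqOn r.integrand (fun x => (x 0) ^ (-(8:ℝ)/9) * (1 - x 0) ^ (-(5:ℝ)/9) * (x 1) ^ (-(4:ℝ)/9) * (1 - x 1) ^ (-(2:ℝ)/9)) r.domain → r'.domain = {x | x 0 ^ 2 + x 1 ^ 2 < 4} → Set.EqOn r'.integrand (fun _ => (3:ℝ) ^ ((7:ℝ)/6) / 2) r'.domain → Literature.NumberTheory.Transcendental.KZ.Equivalent r r')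

/-- item stmt-KontsevichZagierPeriods-11011 · crux · rank 3 · open · by planner
why it might fail: Cancellation may simply hold: for s = [0,1] it is one Newton–Leibniz move; the motivic shadow (effective → localised formal periods injective) is expected though open (HuberWustholz2022 App. A.4); no instance is in hand (0542 and Das-type square roots untested).
sources: KontsevichZagier2001, §4.1 (P̂ = P[(2πi)⁻¹]; products of representations), HuberWustholz2022, App. A.3–A.4, Ayoub2014, Def. 6 and Conj. 7, AyoubRelKZRevisited, Rem. 1.3, Das2000 (doi:10.1090/s0002-9947-00-02417-x), Deligne1982HodgeCycles, I Thm 7.15, Rem. 7.16, n. 22 (read: paper:galaxy-pdf-8405055998839152860 pp 58-61, 87)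
[crux] CANCELLATION GAP: there are integral representations r, r' and an auxiliary representation s
of NON-ZERO value such that the product representations r×s and r'×s (domains σ×τ, σ'×τ; integrands
f⊗h, f'⊗h — written out by hand, no KZProduct import) ARE connected by the four moves while r and r'
are NOT: the literal calculus proves the identity ∫f·∫h = ∫f'·∫h but cannot cancel ∫h. Implies
¬summit (support CancellationGapRefutes, provable now: Fubini KZ.IntegralRep.setIntegral_prodFun
gives r.value·s.value = r'.value·s.value, cancel the real number s.value ≠ 0, pass to
move-equivalent rational representations by KZ.exists_isRational_equivalent_holds, apply the summit,
compose) and is strictly stronger than ¬summit (the summit embeds FormalRep/relations in ℝ, a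
domain). In ring language (KZProduct/KZProductIdeal: FormalRep/relations is a commutative ring,
relations a two-sided ideal — proved): [s] is a zero-divisor on the class [r]−[r']. Named instances:
(i) s = the unit disc, value π — π-cancellation failure, item 0542 AyoubNotPiCancellation of route
AyoubSpecialisation (implies this crux up to the coordinate permutation putting the disc last, a
change of variables); candidate i -/
@[route_item "route-KontsevichZagierPeriods-Neg", crux]
def CancellationGap : Prop :=
  ∃ (n m k : ℕ) (r : Literature.NumberTheory.Transcendental.KZ.IntegralRep n) (r' : Literature.NumberTheory.Transcendental.KZ.IntegralRep m) (s : Literature.NumberTheory.Transcendental.KZ.IntegralRep k) (rs : Literature.NumberTheory.Transcendental.KZ.IntegralRep (n + k)) (r's : Literature.NumberTheory.Transcendental.KZ.IntegralRep (m + k)), rs.domain = {z | (fun i => z (Fin.castAdd k i)) ∈ r.domain ∧ (fun j => z (Fin.natAdd n j)) ∈ s.domain} ∧ Set.EqOn rs.integrand (fun z => r.integrand (fun i => z (Fin.castAdd k i)) * s.integrand (fun j => z (Fin.natAdd n j))) rs.domain ∧ r's.domain = {z | (fun i => z (Fin.castAdd k i)) ∈ r'.domain ∧ (fun j => z (Fin.natAdd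 m j)) ∈ s.domain} ∧ Set.EqOn r's.integrand (fun z => r'.integrand (fun i => z (Fin.castAdd k i)) * s.integrand (fun j => z (Fin.natAdd m j))) r's.domain ∧ s.value ≠ 0 ∧ Literature.NumberTheory.Transcendental.KZ.Equivalent rs r's ∧ ¬ Literature.NumberTheory.Transcendental.KZ.Equivalent r r'

/-- item stmt-KontsevichZagierPeriods-0312 · support · rank 3 · open · by planner
Positive form of #2. A proof must avoid Γ: candidate strategy = realise the degree-9 Fermat-curve
correspondence behind the identity as semialgebraic changes of variables between (blow-ups of)
(0,1)² pieces plus Newton–Leibniz with algebraic primitives (Rohrlich/Deligne distribution relations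
are induced by the maps x ↦ x³ on Fermat curves — algebraic, finite ⇒ CoV on injectivity cells). If
found, pressure point (b) of route Neg dies at its first instance. [elaborates: yes:
_survey/SketchB.lean; sources: Deligne1982HodgeCycles, KontsevichZagier2001] -/
@[route_item "route-KontsevichZagierPeriods-Neg"]
def TriplicationAccessible : Prop :=
  ∀ (r r' : Literature.NumberTheory.Transcendental.KZ.IntegralRep 2), r.domain = {x | ∀ i, x i ∈ Set.Ioo (0:ℝ) 1} → Set.EqOn r.integrand (fun x => (x 0) ^ (-(8:ℝ)/9) * (1 - x 0) ^ (-(5:ℝ)/9) * (x 1) ^ (-(4:ℝ)/9) * (1 - x 1) ^ (-(2:ℝ)/9)) r.domain → r'.domain = {x | x 0 ^ 2 + x 1 ^ 2 < 4} → Set.EqOn r'.integrand (fun _ => (3:ℝ) ^ ((7:ℝ)/6) / 2) r'.domain → Literature.NumberTheory.Transcendental.KZ.Equivalent r r'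

/-- item stmt-KontsevichZagierPeriods-0313 · support · rank 4 · closed · proved by Summit.KontsevichZagierPeriods.Neg.negObstructionShape_proof @ 3c3867751c78 (prover) · by planner
Provable now: relations = AddSubgroup.closure (union of the four sets) ≤ ker ι by
AddSubgroup.closure_le; the statement gives of r − of r' ∈ relations, contradiction with ι ≠ 0.
Fixes the exact form any refutation (crux #2) must take and hands refuters a certified template.
[elaborates: yes: _survey/SketchA.lean; sources: KontsevichZagier2001] -/
@[route_item "route-KontsevichZagierPeriods-Neg"]
def NegObstructionShape : Prop :=
  (∃ (A : Type) (_ : AddCommGroup A) (ι : Literature.NumberTheory.Transcendental.KZ.FormalRep →+ A), (∀ c ∈ Literature.NumberTheory.Transcendental.KZ.domainAddRel ∪ Literature.NumberTheory.Transcendental.KZ.integrandAddRel ∪ Literature.NumberTheory.Transcendental.KZ.changeOfVariablesRel ∪ Literature.NumberTheory.Transcendental.KZ.newtonLeibnizRel, ι c = 0) ∧ ∃ (n m : ℕ) (r : Literature.NumberTheory.Transcendental.KZ.IntegralRep n) (r' : Literature.NumberTheory.Transcendental.KZ.IntegralRep m), r.IsRational ∧ r'.IsRational ∧ r.value = r'.value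 ∧ ι (Literature.NumberTheory.Transcendental.KZ.of r - Literature.NumberTheory.Transcendental.KZ.of r') ≠ 0) → ¬ KontsevichZagierPeriods

/-- item stmt-KontsevichZagierPeriods-1030 · support · rank 9 · closed · proved by Summit.KontsevichZagierPeriods.Neg.triplicationValueEq_proof @ c72aee93d46f (prover) · by planner
[support] Value equality of the Gauss-triplication pair (same data as crux
NegTriplicationNotAccessible 0311 / TriplicationAccessible 0312 / ExpConservative 0544): ∫_{(0,1)²}
x^{-8/9}(1-x)^{-5/9}·y^{-4/9}(1-y)^{-2/9} = B(1/9,4/9)·B(5/9,7/9) = Γ(1/9)Γ(4/9)Γ(7/9)/Γ(4/3) =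
2π·3^{7/6} = (3^{7/6}/2)·vol{x²+y²<4}. A THEOREM (Gauss 1812), not a bet — it is the second
hypothesis of the restated Assembly (route-repair 2026-08-15), filling the previously unfiled gap
"crux ⇒ an equal-valued non-equivalent pair". Proof path over PROVED material: Tonelli/Fubini on the
open square (volume on Fin 2 → ℝ is the product measure: MeasureTheory.volume_pi, integral_fin_two /
MeasureTheory.integral_prod_mul), each factor is the real form of Mathlib's Complex.betaIntegral
(pattern used in Literature/Analysis/SpecialFunctions/LemniscateConstant.lean and
EquianharmonicConstant.lean: Complex.betaIntegral_eq_Gamma_mul_div /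
Complex.Gamma_mul_Gamma_eq_betaIntegral), then Gauss multiplication n = 3 at z = 1/9 from the
DISCHARGED tree fact Literature.Analysis.SpecialFunctions.GaussMultiplicationFormula_holds
(GammaMultiplication.lean; Mathlib has only duplication) and Complex.Gamma_add_one for Γ(4/3) =
Γ(1/3)/3 -/
@[route_item "route-KontsevichZagierPeriods-Neg"]
def TriplicationValueEq : Prop :=
  ∀ (r r' : Literature.NumberTheory.Transcendental.KZ.IntegralRep 2), r.domain = {x | ∀ i, x i ∈ Set.Ioo (0:ℝ) 1} → Set.EqOn r.integrand (fun x => (x 0) ^ (-(8:ℝ)/9) * (1 - x 0) ^ (-(5:ℝ)/9) * (x 1) ^ (-(4:ℝ)/9) * (1 - x 1) ^ (-(2:ℝ)/9)) r.domain → r'.domain = {x | x 0 ^ 2 + x 1 ^ 2 < 4} → Set.EqOn r'.integrand (fun _ => (3:ℝ) ^ ((7:ℝ)/6) / 2) r'.domain → r.value = r'.value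

-- earlier Assembly (stmt-KontsevichZagierPeriods-0310, replaced 2026-08-15T16:37:17Z -> stmt-KontsevichZagierPeriods-11008): retired by None — (∀ n : ℕ, @Literature.NumberTheory.Transcendental.KZ.exists_isRational_equivalent n) → Literature.NumberTheory.Transcendental.KZ.relations_le_ker_eval → ¬ Literature.NumberTheory.Transcendental.KZPeriodConjecture' → ¬ KontsevichZagierPeriods
/-- item stmt-KontsevichZagierPeriods-11008 · assembly · rank 1 · closed · proved by Summit.KontsevichZagierPeriods.Neg.assembly_proof @ 0a8001820c7f (prover) · by planner
[assembly] Either crux refutes the summit (restated 2026-08-15; the old text named the open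
conjecture KZPeriodConjecture' and two unlisted Literature hypotheses). Provable now: branch
NegTriplicationNotAccessible is literally the deciding theorem `Neg.closes` (proved in this file
from KZ.exists_isRational_equivalent_holds + KZ.Equivalent.value_eq_holds); branch CancellationGap
is support CancellationGapRefutes (proved in the planner's SketchCancel.lean; TriplicationValueEq
unused there). The deciding theorem itself keeps the minimal spine closes :
NegTriplicationNotAccessible → TriplicationValueEq → ¬KontsevichZagierPeriods. -/
@[route_item "route-KontsevichZagierPeriods-Neg"]
def Assembly : Prop :=
  (NegTriplicationNotAccessible ∨ CancellationGap) → TriplicationValueEq → ¬ KontsevichZagierPeriods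

/-! D-0027 §2.1 — DECIDING THEOREM (planner-authored via `route open/edit --closes-file`; by planner-rbadge-KontsevichZagierPeriods-Neg-f4e4ec05-g3-0 2026-08-16T06:17:01Z):
its hypotheses are this route's items and its conclusion the sub-problem Statement (glue_lint), and it elaborates with this file. -/

@[closes "route-KontsevichZagierPeriods-Neg"] theorem closes (h : CancellationGap) : ¬ KontsevichZagierPeriods := by
  intro hS
  obtain ⟨n, m, k, r, r', s, rs, r's, hd, hf, hd', hf', hs0, hE, hnE⟩ := h
  -- values of the hand-written product representations: Fubini over PROVED KZProduct material
  have hv : rs.value = r.value * s.value := by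
    have h1 : rs.value = ∫ z in Literature.NumberTheory.Transcendental.KZ.IntegralRep.prodDomain r s,
        Literature.NumberTheory.Transcendental.KZ.IntegralRep.prodFun r s z := by
      unfold Literature.NumberTheory.Transcendental.KZ.IntegralRep.value
      rw [show rs.domain = Literature.NumberTheory.Transcendental.KZ.IntegralRep.prodDomain r s from hd]
      have hm : MeasurableSet rs.domain :=
        Literature.NumberTheory.Transcendental.KZ.IntegralRep.measurableSet_domain_holds rs
      rw [hd] at hm
      refine MeasureTheory.setIntegral_congr_fun hm ?_
      intro z hz
      exact hf (hd ▸ hz)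
    rw [h1, Literature.NumberTheory.Transcendental.KZ.IntegralRep.setIntegral_prodFun]
  have hv' : r's.value = r'.value * s.value := by
    have h1 : r's.value = ∫ z in Literature.NumberTheory.Transcendental.KZ.IntegralRep.prodDomain r' s,
        Literature.NumberTheory.Transcendental.KZ.IntegralRep.prodFun r' s z := by
      unfold Literature.NumberTheory.Transcendental.KZ.IntegralRep.value
      rw [show r's.domain = Literature.NumberTheory.Transcendental.KZ.IntegralRep.prodDomain r' s from hd']
      have hm : MeasurableSet r's.domain :=
        Literature.NumberTheory.Transcendental.KZ.IntegralRep.measurableSet_domain_holds r's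
      rw [hd'] at hm
      refine MeasureTheory.setIntegral_congr_fun hm ?_
      intro z hz
      exact hf' (hd' ▸ hz)
    rw [h1, Literature.NumberTheory.Transcendental.KZ.IntegralRep.setIntegral_prodFun]
  -- soundness of the four moves on the product pair, then cancel the non-zero REAL number s.value
  have hrr' : r.value = r'.value := by
    have := Literature.NumberTheory.Transcendental.KZ.Equivalent.value_eq_holds hE
    rw [hv, hv'] at this
    exact mul_right_cancel₀ hs0 this
  -- pass to move-equivalent RATIONAL representations (Tarski–Seidenberg, proved) and apply the summit
  obtain ⟨m₁, t, ht, hrt⟩ := Literature.NumberTheory.Transcendental.KZ.exists_isRational_equivalent_holds r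
  obtain ⟨m₂, t', ht', hrt'⟩ := Literature.NumberTheory.Transcendental.KZ.exists_isRational_equivalent_holds r'
  have htt' : t.value = t'.value := by
    rw [← Literature.NumberTheory.Transcendental.KZ.Equivalent.value_eq_holds hrt,
      ← Literature.NumberTheory.Transcendental.KZ.Equivalent.value_eq_holds hrt']
    exact hrr'
  exact hnE ((hrt.trans (hS t t' ht ht' htt')).trans hrt'.symm)

end Summit.KontsevichZagierPeriods.KontsevichZagierPeriods.Theses.Neg
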